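import Summits.QuantumFields.YangMills.Theorems.UnitScaleTiltProp7CmapTwSymInputs
import Summits.QuantumFields.YangMills.Theorems.UnitScaleTiltProp7SectET3Transport
import Literature.MathematicalPhysics.QuantumFieldTheory.Balaban1983to89.B11Prop6Scheme
import Literature.MathematicalPhysics.QuantumFieldTheory.Balaban1983to89.B11Eq111FrakG
import Literature.MathematicalPhysics.QuantumFieldTheory.Balaban1983to89.B11Eq98V0LettersLatticeUniform
import Summits.QuantumFields.YangMills.Theorems.UnitScaleTiltProp7SectET3Objects
import HarnessLib

/-!
# Route `UnitScaleTilt`, crux K1 child «MinimiserStabilityRegPr» (stmt-QuantumFields-19200), stub `stub_existenceMinimalOrbit` (EX) — THE W-SLOT AT THE MEMBER LETTERS,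
# ROW 1: PROPOSITION 4's `C`-SLOT INPUT `Prop4Hyp C̃ C₂ c₄` FOR THE CHART REMAINDER OF RECORD `CmapTwS` READ ON THE SPACE (115) IN A-UNITS (design (W-X′));
# ROW 2: THE V₀-SLOT INPUT `hqV` AT THE BACKGROUND OF RECORD `bgOfCfg F K U₀`

Cell `ym3-torus`, width seat `ym3-torus-px3` (gen 2; LOCATE «WF-SEAM» = 19200 evidence `LOCATE-WF-SEAM-px3g2.md`; EX namer ★w2-19200 g6's design (W) 2026-08-28T19:26:38Z
«`Wf L i U₀ := W80 ρ₂ τ₂ (bgOfCfg U₀) H̃ C̃ εC (Jcur (bgOfCfg U₀)) Δ̃π` READ AT `Pd := periodsT3 F K`» + THE (W) UNITS WORD (W-X′) 19:50:28Z «A-UNITS THROUGHOUT …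
`C̃ U₀ := fun A' ↦ (−Complex.I) • CmapTwS F n K h U₀ ((((eta F n K : ℝ) : ℂ) * Complex.I) • (cfgEquiv F K M₂).symm (JetSup.equiv _ _ _ A'))`»; GOs (G19)∕(G19′) «px3: WF-P4-ROWS»).  YM₃ on T³ is a ladder rung (R3), NOT the Clay
problem; nothing here is a claim about the stub, the crux, d = 4 or the mass gap.  `--supports stmt-QuantumFields-19200 --as helper`; count-neutral; THEOREMS ONLY (0 `def`).

THE PRINT.  [Balaban1985Variational] Prop. 4 p. 292–293 is proved from the chart's quadratic remainder: (44) p. 285 «Q_j(U₀, ηA′) = LʲηQ_jA′ + C_j(A′), |C_j(A′)| ≦ C₂(…)²»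
and Prop. 3 p. 289 (analyticity of the chart), with (115) p. 294 the space `max{|A′|₍₋₁₎, |∇A′|₍₋₂₎}`.  The lit W-slot supplier ✓`B11Eq98CurrentSlot.prop4Hyp_W80` (lattice- and
dimension-free) consumes this as the hypothesis `hC : Prop4Hyp C C₂ c₄` for the functional `C : Space115 … → 𝒳`.

WHAT THIS FILE PROVES (sorry-free; no definition).
* §1 `prop4Hyp_comp_of_norm_le` — [folklore] `Prop4Hyp C C₂ R` for `C : 𝒴 → 𝒵`, `0 ≤ C₂`, and a continuous linear `ℓ : 𝒴′ →L[ℂ] 𝒴` with `‖ℓ y‖ ≤ ‖y‖` give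
  `Prop4Hyp (C ∘ ℓ) C₂ R` (same constants); `quadAnalytic_conj_smul` — `QuadAnalytic W C R`, `c ≠ 0` ⟹ `QuadAnalytic (Y ↦ c⁻¹ • W (c • Y)) (‖c‖C) (R∕‖c‖)`
  (the scalar change of units the (W) assembly conjugates by; EX namer (G19)).
* §2 `norm_zeroJet_le` — at the ONE-LEVEL member (`lev ≡ K − n`, `η = L^{−(K−n)}`: every (115)-weight is `1`, ✓`Prop7SectET3Transport.levWeight_const_eq_one`) the 0-jet
  `A′ ↦ (cfgEquiv F K M₂)⁻¹ (JetSup.equiv A′)` (route carrier `PBond (F.P K) 0 → M₂(ℂ)`, sup norm) is bounded by the (115)-norm: `‖…‖ ≤ ‖A′‖`; `zeroJet_eq_clm` exhibits it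
  as the value of a continuous linear map (for differentiability), no `def`.
* §3 ★ **`prop4Hyp_CmapTwS_conj_zeroJet`** — for a member `(F, n, K)`, `RegPr F n K ε₀ U₀` inside the windows of ✓`Prop7CmapTwSymInputs` (`10⁹L²e ≤ 1`, `10¹²L³ε₀ ≤ 1`):
  `Prop4Hyp (C̃ U₀) (40·(2·(3·(2e + 2700Lε₀)))∕e²) (e∕2)` for design (W-X′)'s A-UNITS chart remainder
  `C̃ U₀ := fun A′ ↦ (−I) • CmapTwS F n K h U₀ (((η:ℂ)·I) • (cfgEquiv F K M₂)⁻¹ (JetSup.equiv A′))` on S9's (115)-space `Space115 L η (fun _ ↦ K−n) (fun _ ↦ K−n)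
  (nabla115 η (bgOfCfg F K U₀))` — the `hC`∕`Regime.quad` input of `prop4Hyp_W80`; constant and radius η-FREE (the knit's `K_L`∕`ε′` classes), from ✓`inputs_CmapTwS`
  (exponent units) by ✓`B11Prop3Model.Inputs.prop4Hyp` ∘ §1 (two-scalar conjugation + contractive 0-jet) ∘ §2.
* §4 the V₀-slot's CLASS rows at the background of record `bgOfCfg F K U₀`: `bgOfCfg_mem_U1` (SU(2) ⊂ `U1`), `star_bgOfCfg_eq_inv` (`U* = U⁻¹`, ✓`isUnitaryBg_bgOfCfg`),
  ★ `norm_plaqHolU_bgOfCfg_sub_one_lt` — `RegPr`'s plaquette clause (2) read on lit-balaban's `plaqHolU (bgOfCfg F K U₀)`: `‖U(∂p) − 1‖ < ε₀·η²` (✓`Prop7SectET3Objects.plaqU_chart`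
  at the chart of record + ✓`norm_holT_unitsField_plaqWord_sub_one` + ✓`dist1_plaqHol_toUField`).
* §5 `wSup_const_le_one`∕`wInvSup_const_le_one` (profile bounds `= 1` at constant levels), `opNorm_le_one_of_contractive`, `opNorm_le_of_applied_bound`, the fibre-generic
  `curV0_quadBound_const_levels` (✓`curV0_quadBound_lattice_uniform` at `lev ≡ k`, `η = L^{−k}`, `ω = Ω = 1`, with `‖τ‖ ≤ 1`, `‖ρ‖ ≤ M_ρ` folded into the constant — the fibre
  letter's size DISPLAYED IN APPLIED FORM `‖ρ ℓ‖ ≤ M_ρ‖ℓ‖`, because the operator-norm instance on `(M₂(ℂ) →L ℂ) →L M₂(ℂ)` does not synthesise at the matrix algebra), and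
  ★ **`hqV_bgOfCfg_of_regPr`** — the `hqV` input of `prop4Hyp_W80` for design (W): at `U₀ := bgOfCfg F K U₀`, `lev ≡ K − n`, `Dc := nabla115 η (bgOfCfg F K U₀)`, for `RegPr F n K ε₀ U₀`,
  a tracial ⋆-compatible contractive `τ` and `‖ρ ℓ‖ ≤ M_ρ‖ℓ‖`: `‖curV0 ρ τ (bgOfCfg F K U₀) Y‖ ≤ (2048·M_ρ·(ε₀ + 1∕16) + 276·M_ρ)·‖Y‖²` on `‖Y‖ < 1∕16` (`R_V = 1∕16`).
HONEST SCOPE.  Bookkeeping over landed theorems (✓`inputs_CmapTwS`, ✓`analyticOnNhd_logChartTwS`); no new estimate; the UNITS of design (W) (exponent vs A-units for `H̃ C̃ Δ̃π J`)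
are the namer's to fix — row 1 is stated in the chart's own exponent units, row 2 in the V₀ letters' native units; the kernel-column rows `hΘE hΘ3`, the (3.133)-class column of `H`,
the `Regime` numerics and the (W) assembly `quadAnalytic_Wf80_of_rows` are NOT here (they wait for the namer's units word).

References: T. Bałaban, CMP 102 (1985) 277–309 [Balaban1985Variational] ((2) p.278, (44) p.285, Prop. 3 p.289, (90)–(96) pp.291–292, Prop. 4 (97)–(98) pp.292–293, (115) p.294);
CMP 99 (1985) 389–434 [Balaban1985BackgroundPropagators] ((3.1) p.390, (3.13)–(3.14) p.393, (3.35) p.396).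
-/

set_option autoImplicit false

noncomputable section

open Metric Set
open scoped Matrix.Norms.L2Operator

namespace Summit.QuantumFields.YangMills.Theorems.Prop7SectET3WCurrentProp4Rows

open Literature.MathematicalPhysics.QuantumFieldTheory.Balaban1983to89
open Literature.MathematicalPhysics.QuantumFieldTheory.Balaban1983to89.T3ContinuumYM3Torus
open Literature.MathematicalPhysics.QuantumFieldTheory.Balaban1983to89.T3Thm1Carrier
open Literature.MathematicalPhysics.QuantumFieldTheory.Balaban1983to89.T3PrintedRegularMinimiser (RegPr)
open Literature.MathematicalPhysics.QuantumFieldTheory.Balaban1983to89.T3SectALandauChart (eta eta_pos)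
open B9SectCLatticeCarrier (Bond)
open B11Eq115Space (NegSup NegSize Space115 JetSup levWeight)
open B11Eq111FrakG (nabla115)
open B11Prop6Scheme (Prop4Hyp)
open B13Contraction113 (QuadAnalytic)
open Summit.QuantumFields.YangMills.Theorems.Prop7SectET3Transport (periodsT3 bgOfCfg bondEquiv cfgEquiv norm_cfgEquiv_symm levWeight_const_eq_one)
open Summit.QuantumFields.YangMills.Theorems.Prop7SymAvgTwSym (QTwS CmapTwS)
open Summit.QuantumFields.YangMills.Theorems.Prop7CmapTwSymInputs (inputs_CmapTwS)
open Summit.QuantumFields.YangMills.Theorems.Prop7SectET3Transport (siteEquiv siteEquiv_shiftEquiv bgOfCfg_eq isUnitaryBg_bgOfCfg)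
open Summit.QuantumFields.YangMills.Theorems.Prop7SectET3Objects (plaqU_chart)
open Literature.MathematicalPhysics.QuantumFieldTheory.Balaban1983to89.T3RegularMinimiser (regThreshold)
open B10Eq27TorusAxialLog (toUField unitsField unitsField_mem_unitaryUnits U1_of_unitaryUnits norm_holT_unitsField_plaqWord_sub_one dist1_plaqHol_toUField)
open B7Prop1Explicit (U1)
open B9Eq310DeltaPrime (plaqHolU)
open B9Eq310DeltaPrimeJunction (plaqHolU_eq_plaqU)
open B11Eq63V0GroupCurrent (curV0)
open B11Eq98V0LettersLatticeUniform (curV0_quadBound_lattice_uniform)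

/-! ## §1 `Prop4Hyp` is stable under a norm-non-increasing linear change of variable -/

/-- **[folklore] `Prop4Hyp` ALONG A CONTRACTIVE LINEAR MAP**: if `‖C Y‖ ≤ C₂‖Y‖²` and `C` is holomorphic on `‖Y‖ < R`, and `ℓ` is continuous linear with `‖ℓ y‖ ≤ ‖y‖`,
then `C ∘ ℓ` has the same two properties with the same constants (`ℓ` maps the `R`-ball into the `R`-ball). [cite: Balaban1985Variational, Prop. 4 (98) p.293] -/
theorem prop4Hyp_comp_of_norm_le {𝒴 𝒴' 𝒵 : Type*} [NormedAddCommGroup 𝒴] [NormedSpace ℂ 𝒴] [NormedAddCommGroup 𝒴'] [NormedSpace ℂ 𝒴']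
    [NormedAddCommGroup 𝒵] [NormedSpace ℂ 𝒵] {C : 𝒴 → 𝒵} {C₂ R : ℝ} (hC : Prop4Hyp C C₂ R) (hC₂ : 0 ≤ C₂)
    (ℓ : 𝒴' →L[ℂ] 𝒴) (hℓ : ∀ y, ‖ℓ y‖ ≤ ‖y‖) : Prop4Hyp (fun y => C (ℓ y)) C₂ R where
  quad y hy := by
    have h1 : ‖ℓ y‖ < R := (hℓ y).trans_lt hy
    have h2 : ‖ℓ y‖ ^ 2 ≤ ‖y‖ ^ 2 := pow_le_pow_left₀ (norm_nonneg _) (hℓ y) 2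
    exact (hC.quad (ℓ y) h1).trans (mul_le_mul_of_nonneg_left h2 hC₂)
  differentiableOn := hC.differentiableOn.comp ℓ.differentiable.differentiableOn fun y hy => (hℓ y).trans_lt hy

/-- **[folklore] `Prop4Hyp` UNDER TWO SCALAR CHANGES OF UNITS** (the (W-X′) conjugation `Y ↦ κ_c⁻¹ • C(κ_f • Y)`): `Prop4Hyp W C R`, `b ≠ 0` ⟹
`Prop4Hyp (Y ↦ a • W (b • Y)) (‖a‖·‖b‖²·C) (R ∕ ‖b‖)`. [cite: Balaban1985Variational, (44) p.285, Prop. 4 (98) p.293] -/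
theorem prop4Hyp_smul_comp_smul {𝒴 𝒵 : Type*} [NormedAddCommGroup 𝒴] [NormedSpace ℂ 𝒴] [NormedAddCommGroup 𝒵] [NormedSpace ℂ 𝒵]
    {W : 𝒴 → 𝒵} {C R : ℝ} (hW : Prop4Hyp W C R) (a : ℂ) {b : ℂ} (hb : b ≠ 0) :
    Prop4Hyp (fun Y => a • W (b • Y)) (‖a‖ * ‖b‖ ^ 2 * C) (R / ‖b‖) where
  quad Y hY := by
    have hb0 : 0 < ‖b‖ := norm_pos_iff.mpr hb
    have hbY : ‖b • Y‖ < R := by rw [norm_smul]; rwa [lt_div_iff₀ hb0, mul_comm] at hY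
    have h := hW.quad (b • Y) hbY
    rw [norm_smul] at h
    rw [norm_smul]
    calc ‖a‖ * ‖W (b • Y)‖ ≤ ‖a‖ * (C * (‖b‖ * ‖Y‖) ^ 2) := mul_le_mul_of_nonneg_left h (norm_nonneg _)
      _ = ‖a‖ * ‖b‖ ^ 2 * C * ‖Y‖ ^ 2 := by ring
  differentiableOn := by
    have hb0 : 0 < ‖b‖ := norm_pos_iff.mpr hb
    have hmaps : Set.MapsTo (fun Y : 𝒴 => b • Y) {Y : 𝒴 | ‖Y‖ < R / ‖b‖} {Y : 𝒴 | ‖Y‖ < R} := by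
      intro Y hY
      simp only [Set.mem_setOf_eq] at hY ⊢
      rw [norm_smul]; rwa [lt_div_iff₀ hb0, mul_comm] at hY
    exact ((hW.differentiableOn.comp (differentiable_id.const_smul b).differentiableOn hmaps).const_smul a)

/-- **[folklore] `QuadAnalytic` UNDER A SCALAR CHANGE OF UNITS** (the namer's conjugation between A-units and exponent units, `c = η·I` or `η`):
`QuadAnalytic W C R`, `c ≠ 0` ⟹ `QuadAnalytic (Y ↦ c⁻¹ • W (c • Y)) (‖c‖·C) (R ∕ ‖c‖)`. [cite: Balaban1985Variational, (44) p.285, Prop. 4 (98) p.293] -/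
theorem quadAnalytic_conj_smul {𝒴 𝒵 : Type*} [NormedAddCommGroup 𝒴] [NormedSpace ℂ 𝒴] [NormedAddCommGroup 𝒵] [NormedSpace ℂ 𝒵]
    {W : 𝒴 → 𝒵} {C R : ℝ} (hW : QuadAnalytic W C R) {c : ℂ} (hc : c ≠ 0) :
    QuadAnalytic (fun Y => c⁻¹ • W (c • Y)) (‖c‖ * C) (R / ‖c‖) where
  quad Y hY := by
    have hc0 : 0 < ‖c‖ := norm_pos_iff.mpr hc
    have hcY : ‖c • Y‖ < R := by rw [norm_smul]; rwa [lt_div_iff₀ hc0, mul_comm] at hY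
    have h := hW.quad (c • Y) hcY
    rw [norm_smul] at h
    rw [norm_smul, norm_inv, inv_mul_le_iff₀ hc0]
    calc ‖W (c • Y)‖ ≤ C * (‖c‖ * ‖Y‖) ^ 2 := h
      _ = ‖c‖ * (‖c‖ * C * ‖Y‖ ^ 2) := by ring
  lineAnalytic P Q := by
    have hc0 : 0 < ‖c‖ := norm_pos_iff.mpr hc
    have h := hW.lineAnalytic (c • P) (c • Q)
    have hset : {ζ : ℂ | ‖P + ζ • Q‖ < R / ‖c‖} = {ζ : ℂ | ‖c • P + ζ • (c • Q)‖ < R} := by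
      ext ζ
      simp only [Set.mem_setOf_eq]
      rw [smul_comm ζ c Q, ← smul_add, norm_smul, lt_div_iff₀ hc0, mul_comm]
    have hfun : (fun ζ : ℂ => c⁻¹ • W (c • (P + ζ • Q))) = fun ζ : ℂ => c⁻¹ • W (c • P + ζ • (c • Q)) := by
      funext ζ; rw [smul_add, smul_comm c ζ Q]
    rw [hset, hfun]
    exact h.const_smul c⁻¹

/-! ## §2 The 0-jet of the space (115) at the one-level member, read on the route carrier -/

section ZeroJet

variable (F : T3Family) (n K : ℕ) [Fact (0 < (F.L : ℝ))] [Fact (0 < ((F.L : ℝ)⁻¹) ^ (K - n))]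
  (U₀ : GaugeField (F.P K) 0 (Matrix.specialUnitaryGroup (Fin 2) ℂ))

/-- **THE 0-JET IS (115)-BOUNDED AT THE ONE-LEVEL MEMBER**: with `lev ≡ K − n`, `η = L^{−(K−n)}` all weights are `1`, so `‖(cfgEquiv F K M₂)⁻¹ (JetSup.equiv A′)‖ = |A′|₍₋₁₎ ≤ ‖A′‖₍₁₁₅₎`.
[cite: Balaban1985Variational, (115) p.294, (2) p.278] -/
theorem norm_zeroJet_le
    (A' : Space115 (F.L : ℝ) (((F.L : ℝ)⁻¹) ^ (K - n)) (fun _ : Bond 3 (periodsT3 F K) => K - n)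
        (fun _ : Bond 3 (periodsT3 F K) × Fin 3 => K - n) (nabla115 (((F.L : ℝ)⁻¹) ^ (K - n)) (bgOfCfg F K U₀))) :
    ‖(cfgEquiv F K (Matrix (Fin 2) (Fin 2) ℂ)).symm (JetSup.equiv _ _ _ A')‖ ≤ ‖A'‖ := by
  rw [norm_cfgEquiv_symm]
  have hL : (F.L : ℝ) ≠ 0 := (Fact.out : 0 < (F.L : ℝ)).ne'
  refine (pi_norm_le_iff_of_nonneg (norm_nonneg A')).2 fun b => ?_
  have h := JetSup.weight_mul_norm_apply_le A' b
  rwa [levWeight_const_eq_one hL, one_mul] at h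

/-- The 0-jet read on the route carrier IS a continuous linear map (the composite `proj ∘ NegSup.equiv ∘ fst`), stated pointwise — for the differentiability clause.
[folklore] -/
theorem zeroJet_eq_clm
    (A' : Space115 (F.L : ℝ) (((F.L : ℝ)⁻¹) ^ (K - n)) (fun _ : Bond 3 (periodsT3 F K) => K - n)
        (fun _ : Bond 3 (periodsT3 F K) × Fin 3 => K - n) (nabla115 (((F.L : ℝ)⁻¹) ^ (K - n)) (bgOfCfg F K U₀))) :
    (cfgEquiv F K (Matrix (Fin 2) (Fin 2) ℂ)).symm (JetSup.equiv _ _ _ A') =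
      ((ContinuousLinearMap.pi fun b : PBond (F.P K) 0 =>
          ContinuousLinearMap.proj (R := ℂ) (φ := fun _ : Bond 3 (periodsT3 F K) => Matrix (Fin 2) (Fin 2) ℂ) (bondEquiv F K b)).comp
        ((NegSup.continuousLinearEquiv ℂ (levWeight (F.L : ℝ) (((F.L : ℝ)⁻¹) ^ (K - n)) (fun _ : Bond 3 (periodsT3 F K) => K - n) 1)).toContinuousLinearMap.comp
          (JetSup.fstCLM (levWeight (F.L : ℝ) (((F.L : ℝ)⁻¹) ^ (K - n)) (fun _ : Bond 3 (periodsT3 F K) => K - n) 1)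
            (levWeight (F.L : ℝ) (((F.L : ℝ)⁻¹) ^ (K - n)) (fun _ : Bond 3 (periodsT3 F K) × Fin 3 => K - n) 2)
            (nabla115 (((F.L : ℝ)⁻¹) ^ (K - n)) (bgOfCfg F K U₀))))) A' := by
  rfl

end ZeroJet

/-! ## §3 ★ The `C`-slot input of `prop4Hyp_W80` for design (W)'s `C̃` -/

section Row

variable (F : T3Family) {n K : ℕ} (h : n ≤ K) {ε₀ e : ℝ} (hε₀ : 0 < ε₀) (he : 0 < e)
  (hWe : 10 ^ 9 * (F.L : ℝ) ^ 2 * e ≤ 1) (hWε : 10 ^ 12 * (F.L : ℝ) ^ 3 * ε₀ ≤ 1)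
  (U₀ : GaugeField (F.P K) 0 (Matrix.specialUnitaryGroup (Fin 2) ℂ)) (hreg : RegPr F n K ε₀ U₀)

include hε₀ he hWe hWε hreg in
/-- ★ **PROP. 4's `C`-SLOT INPUT FOR THE CHART REMAINDER OF RECORD IN A-UNITS — design (W-X′)'s `C̃` (EX namer ★w2-19200 g6 2026-08-28T19:50:28Z):**
`C̃ U₀ := fun A′ ↦ (−I) • CmapTwS F n K h U₀ (((η:ℂ)·I) • (cfgEquiv F K M₂)⁻¹ (JetSup.equiv A′))` (`= κ_c⁻¹ • CmapTwS(κ_f • ιA′)`, `κ_f = η·I`, `κ_c = I`, `η = L^{−(K−n)}`) on S9's member space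
`Space115 L η (fun _ ↦ K−n) (fun _ ↦ K−n) (nabla115 η (bgOfCfg F K U₀))`, for `RegPr F n K ε₀ U₀` inside ✓`Prop7CmapTwSymInputs`' windows (`10⁹L²e ≤ 1`, `10¹²L³ε₀ ≤ 1`):
`Prop4Hyp (C̃ U₀) (40·(2·(3·(2e + 2700Lε₀)))∕e²) (e∕2)` — constant and radius `η`-FREE (`= C₂ˢ·η²` and `(eη∕2)∕η`: the `K_L`-class constant and the `ε′`-class radius of the knit),
from ✓`inputs_CmapTwS` (exponent units, `C₂ˢ = 40·(…)∕(eη)²`, radius `2·(eη∕4)`) by the two-scalar conjugation (§1 `prop4Hyp_smul_comp_smul`, `‖−I‖ = 1`, `‖η·I‖ = η`) and the contractive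
0-jet (§1 `prop4Hyp_comp_of_norm_le`, §2). `.quadAnalytic` gives `Regime.quad`. [cite: Balaban1985Variational, (44) p.285, Prop. 3 p.289, Prop. 4 (97)–(98) pp.292–293, (115) p.294] -/
theorem prop4Hyp_CmapTwS_conj_zeroJet [Fact (0 < (F.L : ℝ))] [Fact (0 < ((F.L : ℝ)⁻¹) ^ (K - n))] :
    Prop4Hyp
      (fun A' : Space115 (F.L : ℝ) (((F.L : ℝ)⁻¹) ^ (K - n)) (fun _ : Bond 3 (periodsT3 F K) => K - n)
          (fun _ : Bond 3 (periodsT3 F K) × Fin 3 => K - n) (nabla115 (((F.L : ℝ)⁻¹) ^ (K - n)) (bgOfCfg F K U₀)) =>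
        (-Complex.I) • CmapTwS F n K h U₀
          ((((eta F n K : ℝ) : ℂ) * Complex.I) • (cfgEquiv F K (Matrix (Fin 2) (Fin 2) ℂ)).symm (JetSup.equiv _ _ _ A')))
      (40 * (2 * (3 * (2 * e + 2700 * (F.L : ℝ) * ε₀))) / e ^ 2) (e / 2) := by
  -- Prop. 3's inputs for the chart of record at the trivial `H := 0` (only the `C`-side fields are used), in Fréchet form, exponent units
  have hI := inputs_CmapTwS F h hε₀ he hWe hWε U₀ hreg (B₀ := 0)
    (H := (0 : (PBond (F.P n) 0 → Matrix (Fin 2) (Fin 2) ℂ) →ₗ[ℂ] (PBond (F.P K) 0 → Matrix (Fin 2) (Fin 2) ℂ)))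
    (fun X => by simp)
  have hP := hI.prop4Hyp
  have hη : 0 < eta F n K := eta_pos F n K
  have hb : (((eta F n K : ℝ) : ℂ) * Complex.I) ≠ 0 :=
    mul_ne_zero (Complex.ofReal_ne_zero.mpr hη.ne') Complex.I_ne_zero
  -- the two-scalar conjugation `κ_c⁻¹ • C(κ_f • ·)`
  have hconj := prop4Hyp_smul_comp_smul hP (-Complex.I) hb
  have hnb : ‖((eta F n K : ℝ) : ℂ) * Complex.I‖ = eta F n K := by
    rw [norm_mul, Complex.norm_I, mul_one, Complex.norm_real, Real.norm_of_nonneg hη.le]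
  have hna : ‖(-Complex.I)‖ = 1 := by rw [norm_neg, Complex.norm_I]
  have hC : ‖(-Complex.I)‖ * ‖((eta F n K : ℝ) : ℂ) * Complex.I‖ ^ 2 * (40 * (2 * (3 * (2 * e + 2700 * (F.L : ℝ) * ε₀))) / (e * eta F n K) ^ 2)
      = 40 * (2 * (3 * (2 * e + 2700 * (F.L : ℝ) * ε₀))) / e ^ 2 := by
    rw [hna, hnb]; field_simp
  have hR : 2 * (e * eta F n K / 4) / ‖((eta F n K : ℝ) : ℂ) * Complex.I‖ = e / 2 := by
    rw [hnb]; field_simp; ring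
  rw [hC, hR] at hconj
  -- pull back along the contractive 0-jet (a continuous linear map, §2)
  have hC₂ : 0 ≤ 40 * (2 * (3 * (2 * e + 2700 * (F.L : ℝ) * ε₀))) / e ^ 2 := by
    have : 0 < (F.L : ℝ) := Fact.out
    positivity
  have hcomp := prop4Hyp_comp_of_norm_le hconj hC₂
    ((ContinuousLinearMap.pi fun b : PBond (F.P K) 0 =>
          ContinuousLinearMap.proj (R := ℂ) (φ := fun _ : Bond 3 (periodsT3 F K) => Matrix (Fin 2) (Fin 2) ℂ) (bondEquiv F K b)).comp
        ((NegSup.continuousLinearEquiv ℂ (levWeight (F.L : ℝ) (((F.L : ℝ)⁻¹) ^ (K - n)) (fun _ : Bond 3 (periodsT3 F K) => K - n) 1)).toContinuousLinearMap.comp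
          (JetSup.fstCLM (levWeight (F.L : ℝ) (((F.L : ℝ)⁻¹) ^ (K - n)) (fun _ : Bond 3 (periodsT3 F K) => K - n) 1)
            (levWeight (F.L : ℝ) (((F.L : ℝ)⁻¹) ^ (K - n)) (fun _ : Bond 3 (periodsT3 F K) × Fin 3 => K - n) 2)
            (nabla115 (((F.L : ℝ)⁻¹) ^ (K - n)) (bgOfCfg F K U₀)))))
    (fun A' => by rw [← zeroJet_eq_clm F n K U₀ A']; exact norm_zeroJet_le F n K U₀ A')
  -- the composite IS the displayed lambda (pointwise `rfl`, §2)
  refine ⟨fun A' hA' => ?_, ?_⟩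
  · have := hcomp.quad A' hA'
    rwa [← zeroJet_eq_clm F n K U₀ A'] at this
  · have hd := hcomp.differentiableOn
    refine hd.congr fun A' _ => ?_
    rw [← zeroJet_eq_clm F n K U₀ A']

end Row

/-! ## §4 The V₀-slot's class rows at the background of record `bgOfCfg F K U₀` -/

section ClassRows

variable (F : T3Family) {n : ℕ} (K : ℕ) (U₀ : GaugeField (F.P K) 0 (Matrix.specialUnitaryGroup (Fin 2) ℂ))

/-- The background of record is `U1`-valued (`‖U(b)‖ ≤ 1`, `‖U(b)⁻¹‖ ≤ 1`: SU(2) ⊂ U(2)). [cite: Balaban1985Variational, p.277] -/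
theorem bgOfCfg_mem_U1 (b : Bond 3 (periodsT3 F K)) : bgOfCfg F K U₀ b ∈ U1 (Matrix (Fin 2) (Fin 2) ℂ) := by
  letI : CStarAlgebra (Matrix (Fin 2) (Fin 2) ℂ) := B10Eq29TubeLine.cstarAlgebraMatrix 2
  rw [bgOfCfg_eq]
  exact U1_of_unitaryUnits (fun b' => unitsField_mem_unitaryUnits (toUField U₀) b') _

/-- The background of record satisfies `U(b)* = U(b)⁻¹` bondwise (the `hUst` row of the V₀ letters). [cite: Balaban1985Variational, p.277] -/
theorem star_bgOfCfg_eq_inv (b : Bond 3 (periodsT3 F K)) :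
    star ((bgOfCfg F K U₀ b : (Matrix (Fin 2) (Fin 2) ℂ)ˣ) : Matrix (Fin 2) (Fin 2) ℂ) = (((bgOfCfg F K U₀ b)⁻¹ : (Matrix (Fin 2) (Fin 2) ℂ)ˣ) : Matrix (Fin 2) (Fin 2) ℂ) :=
  (isUnitaryBg_bgOfCfg F K U₀ b).symm

variable {K U₀}

/-- **THE PLAQUETTE WINDOW OF `RegPr` READ ON lit-balaban's PLAQUETTE HOLONOMY OF THE BACKGROUND OF RECORD**: `‖U(∂p) − 1‖ < ε₀·η²`, `η = L^{−(K−n)}`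
(`RegPr`'s clause (2) `|U₀(∂p) − 1| < ε₀L^{−2(K−n)}` through ✓`Prop7SectET3Objects.plaqU_chart` at the chart of record `siteEquiv F K`).
[cite: Balaban1985Variational, (2) p.278; Balaban1985BackgroundPropagators, (3.1) p.390, (3.35) p.396] -/
theorem norm_plaqHolU_bgOfCfg_sub_one_lt {ε₀ : ℝ} (hreg : RegPr F n K ε₀ U₀) (p : B9SectCLatticeCarrier.Plaq 3 (periodsT3 F K)) :
    ‖((plaqHolU (bgOfCfg F K U₀) p : (Matrix (Fin 2) (Fin 2) ℂ)ˣ) : Matrix (Fin 2) (Fin 2) ℂ) - 1‖ < ε₀ * (((F.L : ℝ)⁻¹) ^ (K - n)) ^ 2 := by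
  obtain ⟨y, q⟩ := p
  obtain ⟨x, rfl⟩ : ∃ x : Site (F.P K) 0, siteEquiv F K x = y := ⟨(siteEquiv F K).symm y, Equiv.apply_symm_apply _ _⟩
  have hc := plaqU_chart (siteEquiv F K) (fun x μ => siteEquiv_shiftEquiv F K x μ) U₀ q.1.1 q.1.2 x
  rw [plaqHolU_eq_plaqU, bgOfCfg_eq]
  erw [hc]
  rw [norm_holT_unitsField_plaqWord_sub_one (toUField U₀) x q.2, dist1_plaqHol_toUField]
  have h := hreg.plaqSmall ⟨x, q.1.1, q.1.2, q.2⟩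
  rw [regThreshold, pow_mul'] at h
  · exact h

end ClassRows

/-! ## §5 ★ The V₀-slot input `hqV` of `prop4Hyp_W80` at the background of record -/

/-- A contractive trace letter has operator norm `≤ 1`. [folklore] -/
theorem opNorm_le_one_of_contractive {𝔸 : Type*} [NormedRing 𝔸] [NormedAlgebra ℂ 𝔸] (τ : 𝔸 →L[ℂ] ℂ) (h : ∀ X, ‖τ X‖ ≤ ‖X‖) : ‖τ‖ ≤ 1 :=
  ContinuousLinearMap.opNorm_le_bound _ zero_le_one (fun X => by simpa using h X)

/-- The fibre letter's operator norm from its displayed applied bound. [folklore] -/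
theorem opNorm_le_of_applied_bound {𝔸 : Type*} [NormedRing 𝔸] [NormedAlgebra ℂ 𝔸] (ρ : (𝔸 →L[ℂ] ℂ) →L[ℂ] 𝔸) {M : ℝ} (hM : 0 ≤ M)
    (h : ∀ ℓ : 𝔸 →L[ℂ] ℂ, ‖ρ ℓ‖ ≤ M * ‖ℓ‖) : ‖ρ‖ ≤ M :=
  ContinuousLinearMap.opNorm_le_bound _ hM h

section Profiles

variable {L : ℝ} [Fact (0 < L)] {k : ℕ} [Fact (0 < (L⁻¹) ^ k)]

/-- At constant levels with `η = L^{−k}` the profile supremum `w̄` is `≤ 1`. [cite: Balaban1985Variational, (115) p.294, (2) p.278] -/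
theorem wSup_const_le_one {ι : Type*} [Fintype ι] (hL : L ≠ 0) (m : ℕ) :
    (NegSup.wSup (levWeight L ((L⁻¹) ^ k) (fun _ : ι => k) m) : ℝ) ≤ 1 := by
  have h : NegSup.wSup (levWeight L ((L⁻¹) ^ k) (fun _ : ι => k) m) ≤ 1 :=
    Finset.sup_le fun i _ => by
      rw [← NNReal.coe_le_coe]
      show levWeight L ((L⁻¹) ^ k) (fun _ : ι => k) m i ≤ ((1 : NNReal) : ℝ)
      rw [levWeight_const_eq_one hL, NNReal.coe_one]
  exact_mod_cast h

/-- At constant levels with `η = L^{−k}` the inverse-profile supremum `w̲⁻¹` is `≤ 1`. [cite: Balaban1985Variational, (115) p.294, (2) p.278] -/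
theorem wInvSup_const_le_one {ι : Type*} [Fintype ι] (hL : L ≠ 0) (m : ℕ) :
    (NegSup.wInvSup (levWeight L ((L⁻¹) ^ k) (fun _ : ι => k) m) : ℝ) ≤ 1 := by
  have h : NegSup.wInvSup (levWeight L ((L⁻¹) ^ k) (fun _ : ι => k) m) ≤ 1 :=
    Finset.sup_le fun i _ => by
      rw [← NNReal.coe_le_coe, NNReal.coe_inv]
      show (levWeight L ((L⁻¹) ^ k) (fun _ : ι => k) m i)⁻¹ ≤ ((1 : NNReal) : ℝ)
      rw [levWeight_const_eq_one hL, inv_one, NNReal.coe_one]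
  exact_mod_cast h

end Profiles

section V0Generic

variable {𝔸 : Type*} [NormedRing 𝔸] [NormedAlgebra ℂ 𝔸] [NormOneClass 𝔸] [CompleteSpace 𝔸] [StarRing 𝔸] [StarModule ℂ 𝔸]
  {d : ℕ} {Pd : Fin d → ℕ} {L : ℝ} [Fact (0 < L)] {k : ℕ} [Fact (0 < (L⁻¹) ^ k)]

/-- **THE V₀-SLOT (98)-LETTER AT CONSTANT LEVELS, FIBRE-GENERIC, WITH THE FIBRE∕TRACE LETTERS' SIZES DISPLAYED IN APPLIED FORM** — ✓`curV0_quadBound_lattice_uniform` at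
`lev ≡ k`, `η = L^{−k}` (profile bounds `ω = Ω = 1` discharged), `‖τ‖ ≤ 1` from contractivity and `‖ρ‖ ≤ M_ρ` from `‖ρ ℓ‖ ≤ M_ρ‖ℓ‖`, folded into the constant:
`‖V₀'(Y)‖ ≤ (1024(d−1)M_ρ(α + 1∕16) + 138(d−1)M_ρ)·‖Y‖²` on the `1∕16`-ball, for a `U1`-valued unitary background in the plaquette window `‖U(∂p) − 1‖ ≤ αη²`.
[cite: Balaban1985Variational, (90)–(96) pp.291–292, Prop. 4 (98) p.293; Balaban1985BackgroundPropagators, (3.35) p.396] -/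
theorem curV0_quadBound_const_levels (ρ : (𝔸 →L[ℂ] ℂ) →L[ℂ] 𝔸) (τ : 𝔸 →L[ℂ] ℂ) (hτ : ∀ a b : 𝔸, τ (a * b) = τ (b * a))
    (hτs : ∀ a : 𝔸, τ (star a) = starRingEnd ℂ (τ a)) (hτ1 : ∀ X : 𝔸, ‖τ X‖ ≤ ‖X‖)
    {Mρ : ℝ} (hMρ : 0 ≤ Mρ) (hρ : ∀ ℓ : 𝔸 →L[ℂ] ℂ, ‖ρ ℓ‖ ≤ Mρ * ‖ℓ‖) (hL : 1 ≤ L)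
    {U : Bond d Pd → 𝔸ˣ} (hUb : ∀ b, U b ∈ U1 𝔸) (hUst : ∀ b, star (U b : 𝔸) = (((U b)⁻¹ : 𝔸ˣ) : 𝔸))
    {α : ℝ} (hα : 0 ≤ α) (hpl : ∀ p : B9SectCLatticeCarrier.Plaq d Pd, ‖(plaqHolU U p : 𝔸) - 1‖ ≤ α * ((L⁻¹) ^ k) ^ 2)
    (Y : Space115 L ((L⁻¹) ^ k) (fun _ : Bond d Pd => k) (fun _ : Bond d Pd × Fin d => k) (nabla115 ((L⁻¹) ^ k) U)) (hY : ‖Y‖ < 1 / 16) :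
    ‖curV0 (lev₁ := fun _ : Bond d Pd × Fin d => k) (Dc := nabla115 ((L⁻¹) ^ k) U) ρ τ U Y‖ ≤
      (1024 * ((d - 1 : ℕ) : ℝ) * Mρ * (α + 1 / 16) + ((d - 1 : ℕ) : ℝ) * 138 * Mρ) * ‖Y‖ ^ 2 := by
  have hL0 : L ≠ 0 := (Fact.out : 0 < L).ne'
  have h := curV0_quadBound_lattice_uniform (L := L) (η := (L⁻¹) ^ k) (lev₀ := fun _ : Bond d Pd => k) (lev₁ := fun _ : Bond d Pd × Fin d => k)
    ρ τ hτ hτs hτ1 hL hUb hUst hα hpl (le_refl (1 : ℝ)) (le_refl (1 : ℝ))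
    (wSup_const_le_one hL0 1) (wInvSup_const_le_one hL0 1) (wInvSup_const_le_one hL0 2) Y hY
  have hτn : ‖τ‖ ≤ 1 := opNorm_le_one_of_contractive τ hτ1
  have hρn : ‖ρ‖ ≤ Mρ := opNorm_le_of_applied_bound ρ hMρ hρ
  have hρ0 : 0 ≤ ‖ρ‖ := ContinuousLinearMap.opNorm_nonneg ρ
  have hτ0 : 0 ≤ ‖τ‖ := ContinuousLinearMap.opNorm_nonneg τ
  have hD : 0 ≤ ((d - 1 : ℕ) : ℝ) := Nat.cast_nonneg _
  have h1 : α * ‖τ‖ * (1 : ℝ) ^ 2 + 1 / 16 ≤ α + 1 / 16 := by nlinarith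
  have h2 : ‖ρ‖ * (α * ‖τ‖ * (1 : ℝ) ^ 2 + 1 / 16) ≤ Mρ * (α + 1 / 16) :=
    mul_le_mul hρn h1 (by positivity) hMρ
  have h3 : ‖ρ‖ * ‖τ‖ ≤ Mρ := by nlinarith
  have hconst : 1024 * ((d - 1 : ℕ) : ℝ) * ((1 : ℝ) * 1) ^ 3 * ‖ρ‖ * (α * ‖τ‖ * (1 : ℝ) ^ 2 + 1 / 16)
        + ((d - 1 : ℕ) : ℝ) * ((1 : ℝ) * 1) ^ 3 * (136 + 2 * ((1 : ℝ) * 1)) * ‖ρ‖ * ‖τ‖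
      ≤ 1024 * ((d - 1 : ℕ) : ℝ) * Mρ * (α + 1 / 16) + ((d - 1 : ℕ) : ℝ) * 138 * Mρ := by
    have e1 : 1024 * ((d - 1 : ℕ) : ℝ) * ((1 : ℝ) * 1) ^ 3 * ‖ρ‖ * (α * ‖τ‖ * (1 : ℝ) ^ 2 + 1 / 16)
        = 1024 * ((d - 1 : ℕ) : ℝ) * (‖ρ‖ * (α * ‖τ‖ * (1 : ℝ) ^ 2 + 1 / 16)) := by ring
    have e2 : ((d - 1 : ℕ) : ℝ) * ((1 : ℝ) * 1) ^ 3 * (136 + 2 * ((1 : ℝ) * 1)) * ‖ρ‖ * ‖τ‖ = ((d - 1 : ℕ) : ℝ) * 138 * (‖ρ‖ * ‖τ‖) := by ring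
    rw [e1, e2]
    have h4 : 1024 * ((d - 1 : ℕ) : ℝ) * (‖ρ‖ * (α * ‖τ‖ * (1 : ℝ) ^ 2 + 1 / 16)) ≤ 1024 * ((d - 1 : ℕ) : ℝ) * (Mρ * (α + 1 / 16)) :=
      mul_le_mul_of_nonneg_left h2 (by positivity)
    have h5 : ((d - 1 : ℕ) : ℝ) * 138 * (‖ρ‖ * ‖τ‖) ≤ ((d - 1 : ℕ) : ℝ) * 138 * Mρ := mul_le_mul_of_nonneg_left h3 (by positivity)
    linarith
  exact h.trans (mul_le_mul_of_nonneg_right hconst (sq_nonneg _))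

end V0Generic

section V0Row

variable (F : T3Family) {n K : ℕ} [Fact (0 < (F.L : ℝ))] [Fact (0 < ((F.L : ℝ)⁻¹) ^ (K - n))]

/-- ★ **THE V₀-SLOT INPUT `hqV` OF `prop4Hyp_W80` AT THE BACKGROUND OF RECORD** (design (W)'s `U₀ := bgOfCfg F K U₀`, `lev ≡ K − n`, `Dc := nabla115 η (bgOfCfg F K U₀)`):
for a tracial ⋆-compatible contractive trace letter `τ`, a fibre letter `ρ` with `‖ρ ℓ‖ ≤ M_ρ‖ℓ‖`, and `RegPr F n K ε₀ U₀` (`ε₀ ≥ 0`), on the `1∕16`-ball of S9's (115)-space: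
`‖curV0 ρ τ (bgOfCfg F K U₀) Y‖ ≤ (2048·M_ρ·(ε₀ + 1∕16) + 276·M_ρ)·‖Y‖²` (✓`curV0_quadBound_lattice_uniform` at `d = 3`, `α := ε₀`, `ω = Ω = 1`, `‖τ‖ ≤ 1`; `U1`-valuedness,
`U* = U⁻¹` and the plaquette window from §4). [cite: Balaban1985Variational, (90)–(96) pp.291–292, Prop. 4 (98) p.293, (2) p.278; Balaban1985BackgroundPropagators, (3.35) p.396] -/
theorem hqV_bgOfCfg_of_regPr (ρ : (Matrix (Fin 2) (Fin 2) ℂ →L[ℂ] ℂ) →L[ℂ] Matrix (Fin 2) (Fin 2) ℂ) (τ : Matrix (Fin 2) (Fin 2) ℂ →L[ℂ] ℂ)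
    (hτ : ∀ a b : Matrix (Fin 2) (Fin 2) ℂ, τ (a * b) = τ (b * a)) (hτs : ∀ a : Matrix (Fin 2) (Fin 2) ℂ, τ (star a) = starRingEnd ℂ (τ a))
    (hτ1 : ∀ X : Matrix (Fin 2) (Fin 2) ℂ, ‖τ X‖ ≤ ‖X‖) {Mρ : ℝ} (hMρ : 0 ≤ Mρ)
    (hρ : ∀ ℓ : Matrix (Fin 2) (Fin 2) ℂ →L[ℂ] ℂ, ‖ρ ℓ‖ ≤ Mρ * ‖ℓ‖) {ε₀ : ℝ} (hε₀ : 0 ≤ ε₀)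
    (U₀ : GaugeField (F.P K) 0 (Matrix.specialUnitaryGroup (Fin 2) ℂ)) (hreg : RegPr F n K ε₀ U₀)
    (Y : Space115 (F.L : ℝ) (((F.L : ℝ)⁻¹) ^ (K - n)) (fun _ : Bond 3 (periodsT3 F K) => K - n)
        (fun _ : Bond 3 (periodsT3 F K) × Fin 3 => K - n) (nabla115 (((F.L : ℝ)⁻¹) ^ (K - n)) (bgOfCfg F K U₀))) (hY : ‖Y‖ < 1 / 16) :
    ‖curV0 (lev₁ := fun _ : Bond 3 (periodsT3 F K) × Fin 3 => K - n) (Dc := nabla115 (((F.L : ℝ)⁻¹) ^ (K - n)) (bgOfCfg F K U₀)) ρ τ (bgOfCfg F K U₀) Y‖ ≤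
      (1024 * ((3 - 1 : ℕ) : ℝ) * Mρ * (ε₀ + 1 / 16) + ((3 - 1 : ℕ) : ℝ) * 138 * Mρ) * ‖Y‖ ^ 2 := by
  letI : CStarAlgebra (Matrix (Fin 2) (Fin 2) ℂ) := B10Eq29TubeLine.cstarAlgebraMatrix 2
  have hL1 : (1 : ℝ) ≤ F.L := by exact_mod_cast F.hL.2.le
  exact curV0_quadBound_const_levels ρ τ hτ hτs hτ1 hMρ hρ hL1 (U := bgOfCfg F K U₀) (bgOfCfg_mem_U1 F K U₀) (star_bgOfCfg_eq_inv F K U₀)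
    hε₀ (fun p => (norm_plaqHolU_bgOfCfg_sub_one_lt F hreg p).le) Y hY

end V0Row

end Summit.QuantumFields.YangMills.Theorems.Prop7SectET3WCurrentProp4Rows

end
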